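import Summits.AnomalousDissipation.AnomalousDissipation.Theses.MarginalStabilityChain
import Literature.Analysis.ODE.SchrodingerODE
import Literature.Analysis.ODE.ComplexSecondOrder

/-!
# Sketch — crux-ideate stmt-AnomalousDissipation-3008 (BurgersLayerKH), ideator 2, round 1

First lemmas of the three idea cards, stated over existing declarations (no proofs):

* `PersistenceReduction` / `PersistenceQuant` — card `dissipative-compact-persistence`;
* `NeutralEndpointSign`, `PurelyGrowingBand` — card `odd-evans-ivt`;
* `evansAtZeroAlpha`, `LongWaveSheetModes` — card `vortex-sheet-continuation`.
-/

noncomputable section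

open Filter Topology

namespace Summit.AnomalousDissipation.AnomalousDissipation.Cruxes.BurgersLayerKH

open Summit.AnomalousDissipation.AnomalousDissipation.Theses.MarginalStabilityChain

/-- The Burgers-layer profile in similarity units, `U(y) = ∫₀ʸ e^{-s²/2} ds` (jump `√(2π)`). -/
def erfU (y : ℝ) : ℝ := ∫ s in (0:ℝ)..y, Real.exp (-(s ^ 2) / 2)

/-- `U''(y) = -y e^{-y²/2}`. -/
def erfU'' (y : ℝ) : ℝ := -(y * Real.exp (-(y ^ 2) / 2))

/-- The Rayleigh potential `K = -U''/U = y e^{-y²/2}/U(y)` (`K(0) = 1`; smooth, positive,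
Gaussian tails): class `K⁺`. -/
def erfK (y : ℝ) : ℝ := if y = 0 then 1 else y * Real.exp (-(y ^ 2) / 2) / erfU y

/-- A classical unstable Rayleigh mode of the erf layer: wavenumber `α > 0`, wave speed `c` with
`im c > 0`, a `C²` stream function `φ ≢ 0`, `φ → 0` at `±∞`, and
`(U - c)(φ'' - α²φ) - U''φ = 0` pointwise. -/
def IsRayleighMode (α : ℝ) (c : ℂ) (φ : ℝ → ℂ) : Prop :=
  0 < α ∧ 0 < c.im ∧ ContDiff ℝ 2 φ ∧ (∃ y, φ y ≠ 0) ∧ Tendsto φ atTop (𝓝 0) ∧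
    Tendsto φ atBot (𝓝 0) ∧
    ∀ y : ℝ, ((erfU y : ℂ) - c) * (iteratedDeriv 2 φ y - (α : ℂ) ^ 2 * φ y) -
      (erfU'' y : ℂ) * φ y = 0

/-- Rayleigh (inviscid, unstrained) instability of the erf layer at SOME wavenumber. -/
def RayleighUnstableErf : Prop := ∃ (α : ℝ) (c : ℂ) (φ : ℝ → ℂ), IsRayleighMode α c φ

/-- An eigenmode of the strained viscous layer at Reynolds number `Re`: literally the body of
`BurgersLayerKH` without the growth clause (same `let`s). -/
def IsStrainedMode (Re α : ℝ) (σ : ℂ) (ψ : ℝ → ℂ) : Prop :=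
  let U : ℝ → ℝ := fun y => ∫ s in (0:ℝ)..y, Real.exp (-(s ^ 2) / 2)
  let U'' : ℝ → ℝ := fun y => -(y * Real.exp (-(y ^ 2) / 2))
  let ω : ℝ → ℂ := fun y => -(iteratedDeriv 2 ψ y - (α : ℂ) ^ 2 * ψ y)
  0 < α ∧ ContDiff ℝ 4 ψ ∧ (∃ y, ψ y ≠ 0) ∧ Tendsto ψ atTop (𝓝 0) ∧ Tendsto ψ atBot (𝓝 0) ∧
    (∃ C : ℝ, ∀ y : ℝ, ‖ω y‖ ≤ C * Real.exp (-(y ^ 2) / 4)) ∧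
    ∀ y : ℝ, σ * ω y = -(Complex.I * α * Re) * ((U y : ℂ) * ω y + (U'' y : ℂ) * ψ y) + ω y +
      (y : ℂ) * deriv ω y + iteratedDeriv 2 ω y - (α : ℂ) ^ 2 * ω y

/-! ### Card `dissipative-compact-persistence` -/

/-- **First lemma (reduction).** Any unstable Rayleigh mode of the erf layer persists, with
growth linear in `Re`, under the strain + viscous terms: the crux follows from
`RayleighUnstableErf`. -/
def PersistenceReduction : Prop := RayleighUnstableErf → BurgersLayerKH

/-- **Quantitative form** (what the abstract lemma gives): for every Rayleigh mode `(α, c)` and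
every `ρ > 0` there is `Re₂` such that for `Re ≥ Re₂` the strained viscous operator AT THE SAME
WAVENUMBER has an eigenvalue `σ` with `|σ/Re - (-iαc)| < ρ` — so `re σ ≥ (α·im c - ρ)·Re`. -/
def PersistenceQuant : Prop :=
  ∀ (α : ℝ) (c : ℂ) (φ : ℝ → ℂ), IsRayleighMode α c φ → ∀ ρ : ℝ, 0 < ρ → ∃ Re₂ : ℝ, 0 < Re₂ ∧
    ∀ Re : ℝ, Re₂ ≤ Re → ∃ (σ : ℂ) (ψ : ℝ → ℂ), IsStrainedMode Re α σ ψ ∧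
      ‖σ / (Re : ℂ) + Complex.I * (α : ℂ) * c‖ < ρ

/-- **The a-priori (Lumer–Phillips) bound behind the persistence lemma, ODE form.** In the weight
`e^{y²/2}` the strain + viscous part `B ω = ω'' + yω' + ω - α²ω` is dissipative
(`-re ∫ ω̄ Bω e^{y²/2} = ∫ |(ω e^{y²/2})'|² e^{-y²/2} + α² ∫ |ω|² e^{y²/2}`) and `-iαRe·U` is skew,
so for smooth Gaussian-decaying `ω`:
`re ∫ conj ω · ((λ + iαRe U) ω - B ω) e^{y²/2} ≥ (re λ + α²) ∫ |ω|² e^{y²/2}` — uniformly in `Re`. -/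
def WeightedDissipativity : Prop :=
  ∀ (Re α : ℝ) (lam : ℂ) (ω : ℝ → ℂ), ContDiff ℝ 2 ω →
    (∃ C : ℝ, ∀ y, ‖ω y‖ + ‖deriv ω y‖ + ‖iteratedDeriv 2 ω y‖ ≤ C * Real.exp (-(y ^ 2) / 2)) →
    (lam.re + α ^ 2) * ∫ y, ‖ω y‖ ^ 2 * Real.exp (y ^ 2 / 2) ≤
      (∫ y, (starRingEnd ℂ) (ω y) * ((lam + Complex.I * α * Re * (erfU y : ℂ)) * ω y -
        (iteratedDeriv 2 ω y + (y : ℂ) * deriv ω y + ω y - (α : ℂ) ^ 2 * ω y)) *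
          (Real.exp (y ^ 2 / 2) : ℂ)).re

/-! ### Card `odd-evans-ivt` -/

/-- **Neutral endpoint sign (Weyl-function monotonicity).** There is a neutral wavenumber
`αs > 0` — ground state `φs > 0`, even, of `-φ'' - Kφ = -αs² φ` — and `η > 0` such that for
`αs - η < α < αs` every real solution of `ψ'' = (α² - K)ψ` decaying at `+∞` has
`ψ(0)·ψ'(0) > 0` (the half-line Neumann `m`-function `ψ'(0)/ψ(0)` is strictly increasing in the
energy `E = -α²` and vanishes at `E₀ = -αs²`). -/
def NeutralEndpointSign : Prop :=
  ∃ αs : ℝ, 0 < αs ∧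
    (∃ φs : ℝ → ℝ, Literature.Analysis.ODE.IsSchrodingerSol (fun y => αs ^ 2 - erfK y) φs ∧
      (∀ y, 0 < φs y) ∧ (∀ y, φs (-y) = φs y) ∧ Tendsto φs atTop (𝓝 0)) ∧
    ∃ η : ℝ, 0 < η ∧ ∀ α : ℝ, αs - η < α → α < αs → ∀ ψ : ℝ → ℝ,
      Literature.Analysis.ODE.IsSchrodingerSol (fun y => α ^ 2 - erfK y) ψ →
        Tendsto ψ atTop (𝓝 0) → (∃ y, ψ y ≠ 0) → 0 < ψ 0 * deriv ψ 0

/-- **The real Evans function on the imaginary `c`-axis** (oddness of `U`): for `c = i cᵢ`,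
`cᵢ > 0`, and the Jost solution `ψ₊ ~ e^{-αy}` at `+∞` of `ψ'' = (α² + U''/(U - icᵢ))ψ`, the
Wronskian with its mirror image `ψ₋(y) = conj ψ₊(-y)` is `-2·re(conj ψ₊(0) · ψ₊'(0))`; so a zero
of `G(α,cᵢ) := re(conj ψ₊(0) ψ₊'(0))` is an unstable mode.  Stated: decaying solutions with
`G = 0` are (restrictions of) Rayleigh modes. -/
def RealEvansCriterion : Prop :=
  ∀ (α cᵢ : ℝ), 0 < α → 0 < cᵢ → ∀ ψ ψ' : ℝ → ℂ,
    Literature.Analysis.ODE.IsSol2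
        (fun y => ((α : ℂ) ^ 2 + (erfU'' y : ℂ) / ((erfU y : ℂ) - cᵢ * Complex.I))) ψ ψ' Set.univ →
      Tendsto ψ atTop (𝓝 0) → (∃ y, ψ y ≠ 0) →
      ((starRingEnd ℂ) (ψ 0) * ψ' 0).re = 0 →
        ∃ φ : ℝ → ℂ, IsRayleighMode α (cᵢ * Complex.I) φ ∧ ∀ y, 0 ≤ y → φ y = ψ y

/-- **Purely growing modes just below the neutral wavenumber** (the card's deliverable to the
persistence step): IVT between `G(α, 0⁺) > 0` (`NeutralEndpointSign`) and `G(α, cᵢ) → -α < 0`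
(`cᵢ → ∞`). -/
def PurelyGrowingBand : Prop :=
  ∃ αs : ℝ, 0 < αs ∧ ∃ η : ℝ, 0 < η ∧ ∀ α : ℝ, αs - η < α → α < αs →
    ∃ cᵢ : ℝ, 0 < cᵢ ∧ ∃ φ : ℝ → ℂ, IsRayleighMode α (cᵢ * Complex.I) φ ∧
      ∀ y, φ (-y) = (starRingEnd ℂ) (φ y)

/-! ### Card `vortex-sheet-continuation` -/

/-- The `α = 0` Evans derivative in closed form: with `U± = ±√(π/2)` the far-field values,
`F(0,c) = ((U₊ - c)² + (U₋ - c)²) / ((U₊ - c)(U₋ - c))`; its zeros `c = ± i√(π/2)` are the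
Helmholtz vortex-sheet eigenvalues `(U₊+U₋)/2 ± i(U₊-U₋)/2`. -/
def evansAtZeroAlpha (c : ℂ) : ℂ :=
  let Up : ℂ := (Real.sqrt (Real.pi / 2) : ℂ)
  ((Up - c) ^ 2 + (-Up - c) ^ 2) / ((Up - c) * (-Up - c))

/-- sanity: the sheet eigenvalue is a zero of `F(0,·)` (checkable by `ring`-type algebra). -/
def SheetZero : Prop := evansAtZeroAlpha ((Real.sqrt (Real.pi / 2) : ℂ) * Complex.I) = 0

/-- **Long waves continue the vortex-sheet mode**: for every `ε > 0` there is `α₁ > 0` such that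
every `α ∈ (0, α₁)` carries a purely growing Rayleigh mode with `|cᵢ - √(π/2)| < ε`
(growth `α cᵢ ≈ α ΔU/2`, the Kelvin–Helmholtz rate of the sheet of strength `ΔU = √(2π)`). -/
def LongWaveSheetModes : Prop :=
  ∀ ε : ℝ, 0 < ε → ∃ α₁ : ℝ, 0 < α₁ ∧ ∀ α : ℝ, 0 < α → α < α₁ →
    ∃ cᵢ : ℝ, |cᵢ - Real.sqrt (Real.pi / 2)| < ε ∧ ∃ φ : ℝ → ℂ, IsRayleighMode α (cᵢ * Complex.I) φ

/-! ### How the cards compose (statements only) -/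

/-- either Rayleigh card feeds the persistence card -/
def Composition : Prop :=
  (PurelyGrowingBand → RayleighUnstableErf) ∧ (LongWaveSheetModes → RayleighUnstableErf) ∧
    (PersistenceQuant → PersistenceReduction)

example : PurelyGrowingBand → RayleighUnstableErf := by
  rintro ⟨αs, hαs, η, hη, h⟩
  have hlt : αs - η < αs - η / 2 := by linarith
  have hlt' : αs - η / 2 < αs := by linarith
  obtain ⟨cᵢ, hcᵢ, φ, hφ, -⟩ := h (αs - η / 2) hlt hlt'
  exact ⟨_, _, _, hφ⟩

/-- the Helmholtz sheet eigenvalue `i√(π/2)` kills the numerator of `F(0,·)` (pure algebra). -/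
example : SheetZero := by
  unfold SheetZero evansAtZeroAlpha
  set a : ℂ := (Real.sqrt (Real.pi / 2) : ℂ) with ha
  have hnum : (a - a * Complex.I) ^ 2 + (-a - a * Complex.I) ^ 2 = 0 := by
    have hI : Complex.I ^ 2 = -1 := Complex.I_sq
    linear_combination (2 * a ^ 2) * hI
  simp only
  rw [hnum, zero_div]

example : LongWaveSheetModes → RayleighUnstableErf := by
  intro h
  obtain ⟨α₁, hα₁, h⟩ := h 1 one_pos
  obtain ⟨cᵢ, -, φ, hφ⟩ := h (α₁ / 2) (by positivity) (by linarith)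
  exact ⟨_, _, _, hφ⟩

end Summit.AnomalousDissipation.AnomalousDissipation.Cruxes.BurgersLayerKH

end
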